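import Summits.AtomisticToContinuum.Crystallization.Theses.SoftAnnulusKernel
import Summits.AtomisticToContinuum.Crystallization.Theorems.TwoCentreKissingKernelBondToShells

/-!
# `BondToShells` for route SoftAnnulusKernel (item stmt-AtomisticToContinuum-18406)

The statement is verbatim that of item stmt-AtomisticToContinuum-12084 of route TwoCentreKissingKernel
(`BondOrderTwelve → GapFreeShellRigidity → LocalClosePacking`, all three with identical definientia in the two
route namespaces), proved there as `bondToShells_proof`; the two Props are definitionally equal.
-/

namespace Summit.AtomisticToContinuum.Crystallization.Theorems

/-- **BondToShells (route SoftAnnulusKernel)**, by definitional unfolding from `bondToShells_proof`. -/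
theorem softAnnulusKernel_bondToShells_proof :
    Summit.AtomisticToContinuum.Crystallization.Theses.SoftAnnulusKernel.BondToShells :=
  bondToShells_proof

end Summit.AtomisticToContinuum.Crystallization.Theorems
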